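import Literature.NumberTheory.NumberFields.OddPrimePowerKW
import Literature.NumberTheory.GaloisRepresentations.NoElementaryAbelianCube
import Mathlib.NumberTheory.NumberField.InfinitePlace.Ramification
import HarnessLib

/-!
# Abelian extensions of `ℚ` of `2`-power degree unramified outside `2` are cyclotomic

The case `p = 2` of the Hilbert–Speiser proof of the Kronecker–Weber theorem (Marcus, *Number
Fields*, Ch. 4, Ex. 32), inside an ambient abelian number field `M₀` with group
`G = Gal(M₀/ℚ)`: subfields `E ≤ M₀` are tracked by `H_E = Gal(M₀/E)`, "`E` is unramified
outside `2`" by `I(Q) ≤ H_E` for all maximal `Q ∌ 2` of `𝓞 M₀`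
(`isUnramifiedAt_under_iff_inertia_le`), and "real subfield" by a complex conjugation `c ∈ G`
(`exists_isConj_rat`).

* `not_isUnramifiedAt_of_card_eq_eight` — no abelian number field with group `(ℤ/2ℤ)³` is
  unramified outside `2` (it would be totally ramified at `2` with residue field `𝔽₂`:
  `not_totally_ramified_of_card_eq_eight`, Marcus Ex. 32–33 in Hilbert's form).
* `IntermediateField.le_cyclotomic_eight_of_finrank_eq_two` — hence a quadratic subfield
  unramified outside `2` lies in `ℚ(ζ₈)` (Marcus Ex. 32(a): it is `ℚ(√2)`, `ℚ(i)` or `ℚ(√-2)`).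
* `eq_sup_zpowers_of_index_two`, `isCyclic_quotient_of_conj_mem` — a real subfield `≠ ℚ` of
  `2`-power degree unramified outside `2` contains `ℚ(√2) = ℚ(ζ₈)⁺` as its *only* quadratic
  subfield, so its Galois group is cyclic (Marcus Ex. 32(b), (c)).
* `IntermediateField.le_of_isCyclotomicExtension_of_finrank_eq_two_pow` — Marcus Ex. 32(d)–(f):
  a subfield `F` of degree `2ᵏ` unramified outside `2` lies in `ℚ(ζ_{2^{k+2}})`.

## References

* D. A. Marcus, *Number Fields*, 2nd ed. (2018), Ch. 4, Ex. 32 (p. 102). [Marcus2018]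
* L. C. Washington, *Introduction to Cyclotomic Fields*, 2nd ed. (1997), Ch. 14, proof of
  Thm. 14.1 (the `2`-part). [Washington1997]
-/

noncomputable section

open NumberField Ideal
open scoped Pointwise IsMulCommutative

namespace Literature.NumberTheory.NumberFields

/-! ### Group-theoretic preliminaries -/

/-- For an involution `c ∉ H` of a commutative group: `[G : H] = 2 · [G : H⟨c⟩]`. [folklore] -/
theorem index_sup_zpowers_mul_two {Γ : Type*} [CommGroup Γ] (H : Subgroup Γ) {c : Γ}
    (hc : c ∉ H) (hc2 : c ^ 2 = 1) : (H ⊔ Subgroup.zpowers c).index * 2 = H.index := by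
  have hc1 : c ≠ 1 := fun h => hc (h ▸ H.one_mem)
  have hK : Nat.card (Subgroup.zpowers c) = 2 := by
    rw [Nat.card_zpowers, orderOf_eq_prime hc2 hc1]
  have hrel : H.relIndex (H ⊔ Subgroup.zpowers c) = 2 := by
    rw [Subgroup.relIndex_sup_left]
    show (H.subgroupOf (Subgroup.zpowers c)).index = 2
    have h1 := (H.subgroupOf (Subgroup.zpowers c)).card_mul_index
    rw [hK] at h1
    rcases (Nat.dvd_prime Nat.prime_two).mp (Dvd.intro_left _ h1) with h | h
    · exfalso
      rw [Subgroup.index_eq_one, Subgroup.subgroupOf_eq_top] at h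
      exact hc (h (Subgroup.mem_zpowers c))
    · exact h
  have h := Subgroup.relIndex_mul_index (le_sup_left : H ≤ H ⊔ Subgroup.zpowers c)
  rw [hrel] at h
  rw [mul_comm]
  exact h

/-- A subgroup of index `2ᵗ`, `t ≥ 1`, of a finite commutative group lies in a subgroup of
index `2`. [folklore] -/
theorem exists_le_index_eq_two {Γ : Type*} [CommGroup Γ] [Finite Γ] (H : Subgroup Γ) {t : ℕ}
    (hH : H.index = 2 ^ t) (ht : 1 ≤ t) : ∃ H₂ : Subgroup Γ, H ≤ H₂ ∧ H₂.index = 2 := by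
  haveI : Fact (Nat.Prime 2) := ⟨Nat.prime_two⟩
  have hcardQ : Nat.card (Γ ⧸ H) = 2 ^ t := hH
  obtain ⟨K, hK⟩ := Sylow.exists_subgroup_card_pow_prime 2 (n := t - 1)
    (show 2 ^ (t - 1) ∣ Nat.card (Γ ⧸ H) by rw [hcardQ]; exact pow_dvd_pow 2 (by omega))
  refine ⟨K.comap (QuotientGroup.mk' H), ?_, ?_⟩
  · intro g hg
    rw [Subgroup.mem_comap, QuotientGroup.mk'_apply, (QuotientGroup.eq_one_iff g).mpr hg]
    exact K.one_mem
  · rw [Subgroup.index_comap_of_surjective _ (QuotientGroup.mk'_surjective H)]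
    have h1 := K.card_mul_index
    rw [hK, hcardQ, show 2 ^ t = 2 ^ (t - 1) * 2 by rw [← pow_succ]; congr 1; omega] at h1
    exact Nat.eq_of_mul_eq_mul_left (by positivity) h1

/-- A finite commutative `2`-group with at most one subgroup of index `2` is cyclic: otherwise
it has a quotient `(ℤ/2ℤ)²` (`exists_subgroup_index_eq_sq_not_isCyclic`), which has two distinct
subgroups of index `2`. [folklore] -/
theorem isCyclic_of_index_two_subsingleton {Γ : Type*} [CommGroup Γ] [Finite Γ]
    (hΓ : IsPGroup 2 Γ) (huniq : ∀ A B : Subgroup Γ, A.index = 2 → B.index = 2 → A = B) :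
    IsCyclic Γ := by
  classical
  by_contra hnc
  obtain ⟨N, hNi, hNc⟩ := exists_subgroup_index_eq_sq_not_isCyclic Nat.prime_two hΓ hnc
  have hcardQ : Nat.card (Γ ⧸ N) = 2 ^ 2 := hNi
  have hexp : Monoid.exponent (Γ ⧸ N) = 2 :=
    (not_isCyclic_iff_exponent_eq_prime Nat.prime_two hcardQ).mp hNc
  have hsq : ∀ q : Γ ⧸ N, q ^ 2 = 1 := fun q => hexp ▸ Monoid.pow_exponent_eq_one q
  haveI : Nontrivial (Γ ⧸ N) :=
    Finite.one_lt_card_iff_nontrivial.mp (by rw [hcardQ]; norm_num)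
  obtain ⟨u, hu⟩ := exists_ne (1 : Γ ⧸ N)
  have hU : Nat.card (Subgroup.zpowers u) = 2 := by
    rw [Nat.card_zpowers, orderOf_eq_prime (hsq u) hu]
  obtain ⟨v, hv⟩ : ∃ v : Γ ⧸ N, v ∉ Subgroup.zpowers u := by
    by_contra h
    push Not at h
    have htop : Subgroup.zpowers u = ⊤ := (Subgroup.eq_top_iff' _).mpr h
    rw [htop, Subgroup.card_top, hcardQ] at hU
    norm_num at hU
  have hv1 : v ≠ 1 := fun h => hv (h ▸ Subgroup.one_mem _)
  have hV : Nat.card (Subgroup.zpowers v) = 2 := by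
    rw [Nat.card_zpowers, orderOf_eq_prime (hsq v) hv1]
  have hne : Subgroup.zpowers u ≠ Subgroup.zpowers v := fun h =>
    hv (by rw [h]; exact Subgroup.mem_zpowers v)
  have hidx : ∀ S : Subgroup (Γ ⧸ N), Nat.card S = 2 → S.index = 2 := fun S hS => by
    have h1 := S.card_mul_index
    rw [hS, hcardQ] at h1
    norm_num at h1
    omega
  refine hne (Subgroup.comap_injective (QuotientGroup.mk'_surjective N) (huniq _ _ ?_ ?_))
  · rw [Subgroup.index_comap_of_surjective _ (QuotientGroup.mk'_surjective N)]; exact hidx _ hU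
  · rw [Subgroup.index_comap_of_surjective _ (QuotientGroup.mk'_surjective N)]; exact hidx _ hV

/-! ### Complex conjugations in `Gal(K/ℚ)` -/

/-- Every complex embedding `φ` of a Galois number field `K/ℚ` admits a complex conjugation
`σ ∈ Gal(K/ℚ)`: `φ ∘ σ = conj ∘ φ` (Mathlib: `exists_isConj_of_isRamified` at a complex place,
`σ = 1` at a real one — the unique infinite place of `ℚ` is real). [folklore] -/
theorem exists_isConj_rat (K : Type*) [Field K] [NumberField K] [IsGalois ℚ K] (φ : K →+* ℂ) :
    ∃ σ : K ≃ₐ[ℚ] K, ComplexEmbedding.IsConj φ σ := by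
  by_cases h : InfinitePlace.IsUnramified ℚ (InfinitePlace.mk φ)
  · refine ⟨1, ?_⟩
    rw [ComplexEmbedding.isConj_one_iff, ← InfinitePlace.isReal_mk_iff]
    rcases InfinitePlace.isUnramified_iff.mp h with h | h
    · exact h
    · exfalso
      rw [Subsingleton.elim ((InfinitePlace.mk φ).comap (algebraMap ℚ K)) Rat.infinitePlace] at h
      exact InfinitePlace.not_isReal_iff_isComplex.mpr h Rat.isReal_infinitePlace
  · exact InfinitePlace.exists_isConj_of_isRamified h

/-- A complex conjugation negates square roots of `-1`: if `x² = -1` then `σ x = -x` (as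
`φ x = ±i`). [folklore] -/
theorem _root_.NumberField.ComplexEmbedding.IsConj.apply_eq_neg_of_sq_eq_neg_one {K : Type*}
    [Field K] [Algebra ℚ K] {φ : K →+* ℂ} {σ : K ≃ₐ[ℚ] K} (hσ : ComplexEmbedding.IsConj φ σ)
    {x : K} (hx : x ^ 2 = -1) : σ x = -x := by
  apply φ.injective
  rw [hσ.eq, map_neg]
  have hz : (φ x) ^ 2 = -1 := by rw [← map_pow, hx, map_neg, map_one]
  have hz' : (φ x - Complex.I) * (φ x + Complex.I) = 0 := by
    ring_nf
    rw [Complex.I_sq, hz]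
    ring
  rcases mul_eq_zero.mp hz' with h | h
  · rw [sub_eq_zero.mp h, Complex.star_def, Complex.conj_I]
  · rw [eq_neg_of_add_eq_zero_left h, Complex.star_def, map_neg, Complex.conj_I, neg_neg]

/-- A complex conjugation does not fix a subfield containing a square root of `-1`. [folklore] -/
theorem not_mem_fixingSubgroup_of_isConj {K : Type*} [Field K] [CharZero K] [Algebra ℚ K]
    {φ : K →+* ℂ} {σ : K ≃ₐ[ℚ] K} (hσ : ComplexEmbedding.IsConj φ σ) {E : IntermediateField ℚ K}
    {x : K} (hxE : x ∈ E) (hx : x ^ 2 = -1) : σ ∉ E.fixingSubgroup := by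
  intro h
  have h1 : σ x = x := (IntermediateField.mem_fixingSubgroup_iff _ _).mp h x hxE
  rw [hσ.apply_eq_neg_of_sq_eq_neg_one hx, neg_eq_iff_add_eq_zero, ← two_mul, mul_eq_zero] at h1
  rcases h1 with h1 | h1
  · exact two_ne_zero h1
  · rw [h1, zero_pow two_ne_zero, zero_eq_neg] at hx
    exact one_ne_zero hx

/-- A complex conjugation is an involution: `σ² = 1`. [folklore] -/
theorem _root_.NumberField.ComplexEmbedding.IsConj.sq_eq_one {K : Type*} [Field K] [Algebra ℚ K]
    {φ : K →+* ℂ} {σ : K ≃ₐ[ℚ] K} (hσ : ComplexEmbedding.IsConj φ σ) : σ ^ 2 = 1 := by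
  by_cases h : σ = 1
  · rw [h, one_pow]
  · rw [← ComplexEmbedding.orderOf_isConj_two_of_ne_one hσ h, pow_orderOf_eq_one]

/-! ### No `(ℤ/2ℤ)³`-extension of `ℚ` unramified outside `2` -/

/-- **Marcus, Ch. 4, Ex. 32–33 over `ℚ`.**  There is no abelian number field `M` with
`Gal(M/ℚ) ≅ (ℤ/2ℤ)³` which is unramified at every prime not above `2`: by Minkowski such an `M`
is totally ramified at `2` (`inertia_eq_top_of_isUnramifiedAt`) with residue field `𝔽₂`, which
`not_totally_ramified_of_card_eq_eight` (Hilbert's formula along the seven quadratic subfields)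
forbids. [cite: Marcus2018, Ch. 4, Ex. 32–33 (pp. 101–102)] -/
theorem not_isUnramifiedAt_of_card_eq_eight {M : Type*} [Field M] [NumberField M]
    [IsAbelianGalois ℚ M] (hcard : Nat.card (M ≃ₐ[ℚ] M) = 8) (hexp : ∀ g : M ≃ₐ[ℚ] M, g ^ 2 = 1)
    (hunr : ∀ (Q : Ideal (𝓞 M)) [Q.IsMaximal], ((2 : ℕ) : 𝓞 M) ∉ Q → Algebra.IsUnramifiedAt ℤ Q) :
    False := by
  classical
  haveI : IsMulCommutative (M ≃ₐ[ℚ] M) := IsAbelianGalois.toIsMulCommutative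
  haveI : IsDedekindDomain (integralClosure ℤ M) := integralClosure.isDedekindDomain ℤ ℚ M
  -- a prime `𝔓` of `M` above `2`
  haveI hpmax : (Ideal.span {((2 : ℕ) : ℤ)}).IsMaximal :=
    Ideal.IsPrime.isMaximal
      ((Ideal.span_singleton_prime (by norm_num)).mpr (Nat.prime_iff_prime_int.mp Nat.prime_two))
      (by simp)
  obtain ⟨𝔓, h𝔓max, h𝔓over⟩ :=
    Ideal.exists_maximal_ideal_liesOver_of_isIntegral (S := 𝓞 M) (Ideal.span {((2 : ℕ) : ℤ)})
  have h𝔓ne : 𝔓 ≠ ⊥ := Ideal.IsMaximal.ne_bot_of_isIntegral_int 𝔓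
  have hpP : ((2 : ℕ) : 𝓞 M) ∈ 𝔓 := by
    have : algebraMap ℤ (𝓞 M) ((2 : ℕ) : ℤ) ∈ 𝔓 :=
      (Ideal.mem_of_liesOver 𝔓 (Ideal.span {((2 : ℕ) : ℤ)}) ((2 : ℕ) : ℤ)).mp
        (Ideal.mem_span_singleton_self _)
    simpa using this
  have hunder : 𝔓.under ℤ = Ideal.span {((2 : ℕ) : ℤ)} := h𝔓over.over.symm
  -- `M` is unramified away from `𝔓 ∩ ℤ = (2)`
  have hunr' : ∀ (Q : Ideal (𝓞 M)) [Q.IsMaximal], Q.under ℤ ≠ 𝔓.under ℤ →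
      Algebra.IsUnramifiedAt ℤ Q := by
    intro Q _ hQ
    refine hunr Q fun hpQ => hQ ?_
    rw [hunder]
    have hle : Ideal.span {((2 : ℕ) : ℤ)} ≤ Q.under ℤ := by
      rw [Ideal.span_singleton_le_iff_mem, Ideal.under_def, Ideal.mem_comap, map_natCast]
      exact hpQ
    exact (hpmax.eq_of_le (Ideal.IsMaximal.under ℤ Q).ne_top hle).symm
  -- hence `2` is totally ramified in `M`, with residue degree `1`
  have htot : 𝔓.inertia (M ≃ₐ[ℚ] M) = ⊤ :=
    inertia_eq_top_of_isUnramifiedAt M (M ≃ₐ[ℚ] M) 𝔓 hunr'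
  have hf := (inertiaDeg_eq_one_of_inertia_eq_top M (M ≃ₐ[ℚ] M) 𝔓 htot).1
  have hres : Nat.card (𝓞 M ⧸ 𝔓) = 2 := by
    have h1 := Ideal.pow_inertiaDeg 2 𝔓
    rw [hf, pow_one, Ideal.absNorm_apply, Submodule.cardQuot_apply] at h1
    exact h1.symm
  haveI : Finite (𝓞 M ⧸ 𝔓) := Ideal.finiteQuotientOfFreeOfNeBot 𝔓 h𝔓ne
  have hp𝔭 : (2 : ℤ) ∉ (𝔓.under ℤ) ^ 2 := by
    rw [hunder, Ideal.span_singleton_pow, Ideal.mem_span_singleton]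
    norm_num
  -- Hilbert's argument over `ℤ` (the ring of integers `𝓞 M` is the type `integralClosure ℤ M`)
  haveI : (show Ideal (integralClosure ℤ M) from 𝔓).IsMaximal := h𝔓max
  haveI : Finite (integralClosure ℤ M ⧸ (show Ideal (integralClosure ℤ M) from 𝔓)) :=
    ‹Finite (𝓞 M ⧸ 𝔓)›
  haveI : Module.IsTorsionFree ℤ (integralClosure ℤ M) := by
    haveI := Literature.NumberTheory.GaloisRepresentations.faithfulSMul_integralClosure ℤ
      (K := ℚ) (L := M)
    rw [Module.isTorsionFree_iff_faithfulSMul]; infer_instance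
  have hpP' : (2 : integralClosure ℤ M) ∈ (show Ideal (integralClosure ℤ M) from 𝔓) := hpP
  exact Literature.NumberTheory.GaloisRepresentations.not_totally_ramified_of_card_eq_eight ℤ
    (K := ℚ) (L := M) (show Ideal (integralClosure ℤ M) from 𝔓) h𝔓ne hcard hexp hres htot hpP'
    hp𝔭

/-! ### Inside an ambient abelian number field `M₀` -/

section Ambient

variable {M₀ : Type*} [Field M₀] [NumberField M₀] [IsAbelianGalois ℚ M₀]

/-- `[G : H_E] = [E : ℚ]`. [folklore] -/
theorem index_fixingSubgroup (E : IntermediateField ℚ M₀) :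
    E.fixingSubgroup.index = Module.finrank ℚ E := by
  have h1 := E.fixingSubgroup.card_mul_index
  rw [IsGalois.card_fixingSubgroup_eq_finrank E, IsGalois.card_aut_eq_finrank,
    ← Module.finrank_mul_finrank ℚ E M₀, mul_comm] at h1
  exact Nat.eq_of_mul_eq_mul_right (Module.finrank_pos (R := E) (M := M₀)) h1

/-- The units of `ℤ/8ℤ` square to `1`. [folklore] -/
theorem units_zmod_eight_sq (u : (ZMod 8)ˣ) : u ^ 2 = 1 := by
  have key : ∀ a b : ZMod 8, a * b = 1 → a ^ 2 = 1 := by decide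
  ext
  rw [Units.val_pow_eq_pow_val, Units.val_one]
  exact key _ _ u.mul_inv

omit [IsAbelianGalois ℚ M₀] in
/-- `[ℚ(ζ₈) : ℚ] = 4`. [folklore] -/
theorem finrank_cyclotomic_eight (Cy8 : IntermediateField ℚ M₀) [IsCyclotomicExtension {8} ℚ Cy8] :
    Module.finrank ℚ Cy8 = 4 := by
  haveI : NeZero (8 : ℕ) := ⟨by norm_num⟩
  rw [IsCyclotomicExtension.finrank Cy8 (Polynomial.cyclotomic.irreducible_rat (NeZero.pos (8 : ℕ)))]
  decide

/-- `Gal(ℚ(ζ₈)/ℚ) ≅ (ℤ/8ℤ)ˣ` has exponent `2`: `g² ∈ Gal(M₀/ℚ(ζ₈))` for every `g ∈ Gal(M₀/ℚ)`.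
[folklore] -/
theorem sq_mem_fixingSubgroup_cyclotomic_eight (Cy8 : IntermediateField ℚ M₀)
    [IsCyclotomicExtension {8} ℚ Cy8] (g : M₀ ≃ₐ[ℚ] M₀) : g ^ 2 ∈ Cy8.fixingSubgroup := by
  haveI : NeZero (8 : ℕ) := ⟨by norm_num⟩
  haveI : IsGalois ℚ Cy8 := IsCyclotomicExtension.isGalois {8} ℚ Cy8
  rw [← Cy8.restrictNormalHom_ker, MonoidHom.mem_ker, map_pow]
  have h := units_zmod_eight_sq
    (IsCyclotomicExtension.Rat.galEquivZMod 8 Cy8 (AlgEquiv.restrictNormalHom Cy8 g))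
  rw [← map_pow] at h
  exact (IsCyclotomicExtension.Rat.galEquivZMod 8 Cy8).injective
    (h.trans (map_one (IsCyclotomicExtension.Rat.galEquivZMod 8 Cy8)).symm)

/-- `ℚ(ζ₈) ≤ M₀` is unramified outside `2`: `I(Q) ≤ Gal(M₀/ℚ(ζ₈))` for `Q ∌ 2`. [folklore] -/
theorem inertia_le_fixingSubgroup_cyclotomic_two_pow {j : ℕ} (Cy : IntermediateField ℚ M₀)
    [IsCyclotomicExtension {2 ^ (j + 1)} ℚ Cy] (Q : Ideal (𝓞 M₀)) [Q.IsMaximal]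
    (h2Q : ((2 : ℕ) : 𝓞 M₀) ∉ Q) : Q.inertia (M₀ ≃ₐ[ℚ] M₀) ≤ Cy.fixingSubgroup := by
  haveI : NeZero (2 ^ (j + 1) : ℕ) := ⟨pow_ne_zero _ two_ne_zero⟩
  rw [← isUnramifiedAt_under_iff_inertia_le M₀ Cy Q]
  haveI : (Q.under (𝓞 Cy)).IsMaximal := Ideal.IsMaximal.under (𝓞 Cy) Q
  refine isUnramifiedAt_of_isCyclotomicExtension (n := 2 ^ (j + 1)) Cy (Q.under (𝓞 Cy)) ?_
  intro q hq hqQ hdvd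
  have hq2 : q = 2 := (Nat.prime_dvd_prime_iff_eq hq Nat.prime_two).mp (hq.dvd_of_dvd_pow hdvd)
  subst hq2
  apply h2Q
  rw [Ideal.under_def, Ideal.mem_comap, map_natCast] at hqQ
  exact hqQ

/-- **Marcus, Ch. 4, Ex. 32(a), inside `M₀`.**  A quadratic subfield `E ≤ M₀` unramified outside
`2` (`I(Q) ≤ H_E` for all `Q ∌ 2`) is contained in `ℚ(ζ₈)`: otherwise `E·ℚ(ζ₈)` would be an
abelian field with group `(ℤ/2ℤ)³` unramified outside `2` (`not_isUnramifiedAt_of_card_eq_eight`).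
(Marcus: "`K = ℚ[√2]`, `ℚ[i]`, or `ℚ[√-2]`".) [cite: Marcus2018, Ch. 4, Ex. 32(a) (p. 102)] -/
theorem IntermediateField.le_cyclotomic_eight_of_finrank_eq_two (Cy8 : IntermediateField ℚ M₀)
    [IsCyclotomicExtension {8} ℚ Cy8] (E : IntermediateField ℚ M₀) (hE : Module.finrank ℚ E = 2)
    (hEu : ∀ (Q : Ideal (𝓞 M₀)) [Q.IsMaximal], ((2 : ℕ) : 𝓞 M₀) ∉ Q →
      Q.inertia (M₀ ≃ₐ[ℚ] M₀) ≤ E.fixingSubgroup) :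
    E ≤ Cy8 := by
  classical
  by_contra hle
  have hHE : E.fixingSubgroup.index = 2 := (index_fixingSubgroup E).trans hE
  have hH8 : Cy8.fixingSubgroup.index = 4 :=
    (index_fixingSubgroup Cy8).trans (finrank_cyclotomic_eight Cy8)
  have h8E : ¬ Cy8.fixingSubgroup ≤ E.fixingSubgroup := fun h => hle (by
    rw [← IsGalois.fixedField_fixingSubgroup E, ← IsGalois.fixedField_fixingSubgroup Cy8]
    exact IntermediateField.fixedField_le h)
  -- `H = H_E ∩ H_8` has index `8`
  haveI : (E.fixingSubgroup ⊓ Cy8.fixingSubgroup).Normal := inferInstance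
  have hHi : (E.fixingSubgroup ⊓ Cy8.fixingSubgroup).index = 8 := by
    have h1 := Subgroup.relIndex_mul_index
      (inf_le_right : E.fixingSubgroup ⊓ Cy8.fixingSubgroup ≤ Cy8.fixingSubgroup)
    rw [Subgroup.inf_relIndex_right, hH8] at h1
    have hdvd : E.fixingSubgroup.relIndex Cy8.fixingSubgroup ∣ 2 :=
      hHE ▸ Subgroup.relIndex_dvd_index_of_normal E.fixingSubgroup Cy8.fixingSubgroup
    rcases (Nat.dvd_prime Nat.prime_two).mp hdvd with h | h
    · exact absurd (Subgroup.relIndex_eq_one.mp h) h8E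
    · rw [h] at h1; omega
  -- `N = M₀^H = E·ℚ(ζ₈)`: group of order `8` and exponent `2`, unramified outside `2`
  set N : IntermediateField ℚ M₀ :=
    IntermediateField.fixedField (E.fixingSubgroup ⊓ Cy8.fixingSubgroup) with hN
  haveI : IsGalois ℚ N :=
    IsGalois.of_fixedField_normal_subgroup (E.fixingSubgroup ⊓ Cy8.fixingSubgroup)
  haveI : IsAbelianGalois ℚ N := IsAbelianGalois.tower_bot ℚ N M₀
  have hNfix : N.fixingSubgroup = E.fixingSubgroup ⊓ Cy8.fixingSubgroup :=
    IntermediateField.fixingSubgroup_fixedField _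
  let e : (M₀ ≃ₐ[ℚ] M₀) ⧸ (E.fixingSubgroup ⊓ Cy8.fixingSubgroup) ≃* (N ≃ₐ[ℚ] N) :=
    IsGalois.normalAutEquivQuotient _
  have hcardN : Nat.card (N ≃ₐ[ℚ] N) = 8 := by rw [← Nat.card_congr e.toEquiv]; exact hHi
  have hexpN : ∀ s : N ≃ₐ[ℚ] N, s ^ 2 = 1 := by
    intro s
    obtain ⟨q, rfl⟩ := e.surjective s
    obtain ⟨g, rfl⟩ := QuotientGroup.mk_surjective q
    have hg : g ^ 2 ∈ E.fixingSubgroup ⊓ Cy8.fixingSubgroup :=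
      ⟨by have := Subgroup.pow_index_mem E.fixingSubgroup g; rwa [hHE] at this,
        sq_mem_fixingSubgroup_cyclotomic_eight Cy8 g⟩
    rw [← map_pow, ← QuotientGroup.mk_pow, (QuotientGroup.eq_one_iff (g ^ 2)).mpr hg, map_one]
  have hNu : ∀ (q : Ideal (𝓞 N)) [q.IsMaximal], ((2 : ℕ) : 𝓞 N) ∉ q →
      Algebra.IsUnramifiedAt ℤ q := by
    rw [forall_isUnramifiedAt_iff_forall_inertia_le N 2]
    intro Q _ h2Q
    rw [hNfix]
    exact le_inf (hEu Q h2Q)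
      (inertia_le_fixingSubgroup_cyclotomic_two_pow (j := 2) Cy8 Q h2Q)
  exact not_isUnramifiedAt_of_card_eq_eight hcardN hexpN hNu

/-- **Marcus, Ch. 4, Ex. 32(b), subgroup form.**  Let `c ∈ G` be an involution not fixing
`ℚ(ζ₈)` (a complex conjugation) and `H ≤ G` a subgroup containing `c` and all `I(Q)`, `Q ∌ 2`
(its fixed field is real and unramified outside `2`).  Then every subgroup `H₂ ⊇ H` of index `2`
equals `Gal(M₀/ℚ(ζ₈))·⟨c⟩` — i.e. `ℚ(√2) = ℚ(ζ₈)⁺` is the only quadratic subfield of `M₀^H`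
(Marcus: "`K` contains `ℚ[√2]` … look at `K ∩ ℝ`"). [cite: Marcus2018, Ch. 4, Ex. 32(b)–(c) (p. 102)] -/
theorem eq_sup_zpowers_of_index_two (Cy8 : IntermediateField ℚ M₀)
    [IsCyclotomicExtension {8} ℚ Cy8] {c : M₀ ≃ₐ[ℚ] M₀} (hc2 : c ^ 2 = 1)
    (hc8 : c ∉ Cy8.fixingSubgroup) {H : Subgroup (M₀ ≃ₐ[ℚ] M₀)}
    (hHu : ∀ (Q : Ideal (𝓞 M₀)) [Q.IsMaximal], ((2 : ℕ) : 𝓞 M₀) ∉ Q →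
      Q.inertia (M₀ ≃ₐ[ℚ] M₀) ≤ H)
    (hcH : c ∈ H) {H₂ : Subgroup (M₀ ≃ₐ[ℚ] M₀)} (hle : H ≤ H₂) (hH₂ : H₂.index = 2) :
    H₂ = Cy8.fixingSubgroup ⊔ Subgroup.zpowers c := by
  classical
  haveI : H₂.Normal := inferInstance
  have hE₂ : (IntermediateField.fixedField H₂).fixingSubgroup = H₂ :=
    IntermediateField.fixingSubgroup_fixedField H₂
  have hfin : Module.finrank ℚ (IntermediateField.fixedField H₂) = 2 := by
    rw [← index_fixingSubgroup, hE₂, hH₂]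
  have hE₂u : ∀ (Q : Ideal (𝓞 M₀)) [Q.IsMaximal], ((2 : ℕ) : 𝓞 M₀) ∉ Q →
      Q.inertia (M₀ ≃ₐ[ℚ] M₀) ≤ (IntermediateField.fixedField H₂).fixingSubgroup :=
    fun Q _ h => by rw [hE₂]; exact (hHu Q h).trans hle
  have hle8 := IntermediateField.le_cyclotomic_eight_of_finrank_eq_two Cy8 _ hfin hE₂u
  have h8 : Cy8.fixingSubgroup ≤ H₂ := hE₂ ▸ IntermediateField.fixingSubgroup_le hle8
  have hA : Cy8.fixingSubgroup ⊔ Subgroup.zpowers c ≤ H₂ :=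
    sup_le h8 ((Subgroup.zpowers_le).mpr (hle hcH))
  have hAi : (Cy8.fixingSubgroup ⊔ Subgroup.zpowers c).index = 2 := by
    have h := index_sup_zpowers_mul_two Cy8.fixingSubgroup hc8 hc2
    rw [(index_fixingSubgroup Cy8).trans (finrank_cyclotomic_eight Cy8)] at h
    omega
  symm
  refine Subgroup.eq_of_le_of_card_ge hA (le_of_eq ?_)
  have h1 := (Cy8.fixingSubgroup ⊔ Subgroup.zpowers c).card_mul_index
  have h2 := H₂.card_mul_index
  rw [hAi] at h1
  rw [hH₂, ← h1] at h2
  exact Nat.eq_of_mul_eq_mul_right two_pos h2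

/-- **Marcus, Ch. 4, Ex. 32(c), subgroup form.**  With `c`, `H` as in
`eq_sup_zpowers_of_index_two` and `[G : H]` a power of `2`, the quotient `G/H` (the Galois group
of the real field `M₀^H`, unramified outside `2`) is cyclic: it has at most one subgroup of
index `2` (Marcus: "`L` contains a unique quadratic subfield … this implies that `Gal(L/ℚ)` is
cyclic"). [cite: Marcus2018, Ch. 4, Ex. 32(c) (p. 102)] -/
theorem isCyclic_quotient_of_conj_mem (Cy8 : IntermediateField ℚ M₀)
    [IsCyclotomicExtension {8} ℚ Cy8] {c : M₀ ≃ₐ[ℚ] M₀} (hc2 : c ^ 2 = 1)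
    (hc8 : c ∉ Cy8.fixingSubgroup) {H : Subgroup (M₀ ≃ₐ[ℚ] M₀)}
    (hHu : ∀ (Q : Ideal (𝓞 M₀)) [Q.IsMaximal], ((2 : ℕ) : 𝓞 M₀) ∉ Q →
      Q.inertia (M₀ ≃ₐ[ℚ] M₀) ≤ H)
    (hcH : c ∈ H) {t : ℕ} (hH : H.index = 2 ^ t) : IsCyclic ((M₀ ≃ₐ[ℚ] M₀) ⧸ H) := by
  haveI : H.Normal := inferInstance
  refine isCyclic_of_index_two_subsingleton
    (IsPGroup.of_card (show Nat.card ((M₀ ≃ₐ[ℚ] M₀) ⧸ H) = 2 ^ t from hH)) fun A B hA hB => ?_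
  have key : ∀ S : Subgroup ((M₀ ≃ₐ[ℚ] M₀) ⧸ H), S.index = 2 →
      S.comap (QuotientGroup.mk' H) = Cy8.fixingSubgroup ⊔ Subgroup.zpowers c := by
    intro S hS
    refine eq_sup_zpowers_of_index_two Cy8 hc2 hc8 hHu hcH ?_ ?_
    · intro g hg
      rw [Subgroup.mem_comap, QuotientGroup.mk'_apply, (QuotientGroup.eq_one_iff g).mpr hg]
      exact S.one_mem
    · rw [Subgroup.index_comap_of_surjective _ (QuotientGroup.mk'_surjective H)]; exact hS
  exact Subgroup.comap_injective (QuotientGroup.mk'_surjective H)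
    ((key A hA).trans (key B hB).symm)

/-- **Marcus, *Number Fields*, Ch. 4, Ex. 32(d)–(f): the case `p = 2` of Kronecker–Weber.**
Let `M₀` be an abelian number field containing `Cy = ℚ(ζ_{2^{k+2}})` and let `F ≤ M₀` have degree
`2ᵏ` over `ℚ` and be unramified outside `2` (`I(Q) ≤ Gal(M₀/F)` for all maximal `Q ∌ 2`).  Then
`F ≤ Cy`.  With `c` a complex conjugation, `L = Cy⁺ = M₀^{A}`, `A = H_{Cy}⟨c⟩`, has cyclic group
`G/A` (`isCyclic_quotient_of_conj_mem`); lift a generator to `τ ∈ G` and put `B = H_F ∩ A`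
(`= Gal(M₀/F·L)`), `H' = ⟨τ⟩B` (the field `F'` fixed by `τ` in `F·L`).  Then `H'A = G`
("`F' ∩ L = ℚ`"), `H'⟨c⟩ = G` ("`F' ∩ ℝ = ℚ`", by Ex. 32(b)), so `[G : H'] ≤ 2` and `H' ⊇ H_{Cy}`
("`F' = ℚ, ℚ[i]` or `ℚ[√-2]`", Ex. 32(a)); as `τ^{2ᵏ} ∈ B` ("`τ` has order `2^m`") one gets
`H_{Cy} ≤ A ∩ H' = B ≤ H_F`, i.e. `F ≤ F·L ≤ Cy`. [cite: Marcus2018, Ch. 4, Ex. 32 (p. 102)] -/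
theorem IntermediateField.le_of_isCyclotomicExtension_of_finrank_eq_two_pow {k : ℕ}
    (Cy : IntermediateField ℚ M₀) [IsCyclotomicExtension {2 ^ (k + 2)} ℚ Cy]
    (F : IntermediateField ℚ M₀) (hF : Module.finrank ℚ F = 2 ^ k)
    (hFu : ∀ (Q : Ideal (𝓞 M₀)) [Q.IsMaximal], ((2 : ℕ) : 𝓞 M₀) ∉ Q →
      Q.inertia (M₀ ≃ₐ[ℚ] M₀) ≤ F.fixingSubgroup) :
    F ≤ Cy := by
  classical
  rcases Nat.eq_zero_or_pos k with hk | hk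
  · subst hk
    rw [pow_zero] at hF
    rw [IntermediateField.finrank_eq_one_iff.mp hF]
    exact bot_le
  haveI : NeZero (2 ^ (k + 2) : ℕ) := ⟨pow_ne_zero _ two_ne_zero⟩
  haveI : NeZero (8 : ℕ) := ⟨by norm_num⟩
  haveI : IsGalois ℚ Cy := IsCyclotomicExtension.isGalois {2 ^ (k + 2)} ℚ Cy
  -- a complex conjugation `c`
  obtain ⟨c, hc⟩ := exists_isConj_rat M₀ (Classical.choice (inferInstance : Nonempty (M₀ →+* ℂ)))
  have hc2 : c ^ 2 = 1 := hc.sq_eq_one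
  -- `ℚ(ζ₈) ≤ Cy`, containing `x = ζ₈²` with `x² = -1`
  set ζ : M₀ := algebraMap Cy M₀ (IsCyclotomicExtension.zeta (2 ^ (k + 2)) ℚ Cy) with hζdef
  have hζ : IsPrimitiveRoot ζ (2 ^ (k + 2)) :=
    (IsCyclotomicExtension.zeta_spec (2 ^ (k + 2)) ℚ Cy).map_of_injective
      (algebraMap Cy M₀).injective
  have hζCy : ζ ∈ Cy := by
    rw [hζdef, IntermediateField.algebraMap_apply]
    exact SetLike.coe_mem _
  have hζ8 : IsPrimitiveRoot (ζ ^ 2 ^ (k - 1)) 8 :=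
    hζ.pow (NeZero.pos _) (show 2 ^ (k + 2) = 2 ^ (k - 1) * 8 by
      rw [show (8 : ℕ) = 2 ^ 3 by norm_num, ← pow_add]; congr 1; omega)
  set Cy8 : IntermediateField ℚ M₀ := IntermediateField.adjoin ℚ {ζ ^ 2 ^ (k - 1)} with hCy8
  haveI : IsCyclotomicExtension {8} ℚ Cy8 :=
    hζ8.intermediateField_adjoin_isCyclotomicExtension (K := ℚ)
  have h8Cy : Cy8 ≤ Cy := by
    rw [hCy8, IntermediateField.adjoin_simple_le_iff]
    exact pow_mem hζCy _
  have hxCy8 : (ζ ^ 2 ^ (k - 1)) ^ 2 ∈ Cy8 :=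
    pow_mem (IntermediateField.mem_adjoin_simple_self ℚ _) 2
  have hx : ((ζ ^ 2 ^ (k - 1)) ^ 2) ^ 2 = -1 := by
    rw [← pow_mul, show 2 * 2 = 4 by norm_num]
    exact (hζ8.pow (by norm_num) (show 8 = 4 * 2 by norm_num)).eq_neg_one_of_two_right
  have hc8 : c ∉ Cy8.fixingSubgroup := not_mem_fixingSubgroup_of_isConj hc hxCy8 hx
  have hcCy : c ∉ Cy.fixingSubgroup := fun h => hc8 (IntermediateField.fixingSubgroup_le h8Cy h)
  -- indices and ramification of `H_F`, `H_{Cy}`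
  have hHF : F.fixingSubgroup.index = 2 ^ k := (index_fixingSubgroup F).trans hF
  have hHCy : Cy.fixingSubgroup.index = 2 ^ (k + 1) := by
    rw [index_fixingSubgroup Cy, IsCyclotomicExtension.finrank Cy
      (Polynomial.cyclotomic.irreducible_rat (NeZero.pos (2 ^ (k + 2)))),
      Nat.totient_prime_pow Nat.prime_two (by omega : 0 < k + 2), show k + 2 - 1 = k + 1 by omega]
    simp
  have hCyu : ∀ (Q : Ideal (𝓞 M₀)) [Q.IsMaximal], ((2 : ℕ) : 𝓞 M₀) ∉ Q →
      Q.inertia (M₀ ≃ₐ[ℚ] M₀) ≤ Cy.fixingSubgroup :=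
    fun Q _ h2Q => inertia_le_fixingSubgroup_cyclotomic_two_pow (j := k + 1) Cy Q h2Q
  -- `A = H_{Cy}⟨c⟩`, the group of `L = Cy⁺`; `G/A` is cyclic, generated by the image of `τ`
  set A : Subgroup (M₀ ≃ₐ[ℚ] M₀) := Cy.fixingSubgroup ⊔ Subgroup.zpowers c with hA
  have hAi : A.index = 2 ^ k := by
    have h := index_sup_zpowers_mul_two Cy.fixingSubgroup hcCy hc2
    rw [hHCy, pow_succ] at h
    exact Nat.eq_of_mul_eq_mul_right two_pos h
  have hAu : ∀ (Q : Ideal (𝓞 M₀)) [Q.IsMaximal], ((2 : ℕ) : 𝓞 M₀) ∉ Q →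
      Q.inertia (M₀ ≃ₐ[ℚ] M₀) ≤ A := fun Q _ h => (hCyu Q h).trans le_sup_left
  have hcA : c ∈ A := Subgroup.mem_sup_right (Subgroup.mem_zpowers c)
  haveI : A.Normal := inferInstance
  haveI : IsCyclic ((M₀ ≃ₐ[ℚ] M₀) ⧸ A) := isCyclic_quotient_of_conj_mem Cy8 hc2 hc8 hAu hcA hAi
  obtain ⟨τbar, hτbar⟩ := IsCyclic.exists_generator (α := (M₀ ≃ₐ[ℚ] M₀) ⧸ A)
  obtain ⟨τ, rfl⟩ := QuotientGroup.mk_surjective τbar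
  have hordτ : orderOf (QuotientGroup.mk τ : (M₀ ≃ₐ[ℚ] M₀) ⧸ A) = 2 ^ k := by
    rw [orderOf_eq_card_of_forall_mem_zpowers hτbar]; exact hAi
  -- `B = H_F ∩ A` (the field `F·L`) and `H' = ⟨τ⟩ B` (the field `F'`)
  set B : Subgroup (M₀ ≃ₐ[ℚ] M₀) := F.fixingSubgroup ⊓ A with hB
  set H' : Subgroup (M₀ ≃ₐ[ℚ] M₀) := Subgroup.zpowers τ ⊔ B with hH'
  have hBu : ∀ (Q : Ideal (𝓞 M₀)) [Q.IsMaximal], ((2 : ℕ) : 𝓞 M₀) ∉ Q →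
      Q.inertia (M₀ ≃ₐ[ℚ] M₀) ≤ B := fun Q _ h => le_inf (hFu Q h) (hAu Q h)
  have hBA : B ≤ A := inf_le_right
  -- (d) `H' A = G` ("`F' ∩ L = ℚ`")
  have hd1 : H' ⊔ A = ⊤ := by
    rw [eq_top_iff]
    intro g _
    obtain ⟨j, hj⟩ := Subgroup.mem_zpowers_iff.mp (hτbar (QuotientGroup.mk g))
    rw [← QuotientGroup.mk_zpow, QuotientGroup.eq] at hj
    rw [(mul_inv_cancel_left (τ ^ j) g).symm]
    exact Subgroup.mul_mem _
      (Subgroup.mem_sup_left (Subgroup.mem_sup_left (Subgroup.zpow_mem_zpowers τ j)))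
      (Subgroup.mem_sup_right hj)
  -- `[G : B]` is a power of `2`
  have hBi : ∃ j, B.index = 2 ^ j := by
    have hdvd : B.index ∣ A.index * F.fixingSubgroup.index := by
      rw [hB, ← Subgroup.relIndex_mul_index (inf_le_left : F.fixingSubgroup ⊓ A ≤ F.fixingSubgroup),
        Subgroup.inf_relIndex_left]
      exact Nat.mul_dvd_mul_right (Subgroup.relIndex_dvd_index_of_normal A F.fixingSubgroup) _
    rw [hAi, hHF, ← pow_add] at hdvd
    obtain ⟨j, -, hj⟩ := (Nat.dvd_prime_pow Nat.prime_two).mp hdvd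
    exact ⟨j, hj⟩
  -- (d) `H' ⟨c⟩ = G` ("`F' ∩ ℝ = ℚ`": else `F' ∩ ℝ ⊇ ℚ(√2) ⊆ L`)
  have hA8i : (Cy8.fixingSubgroup ⊔ Subgroup.zpowers c).index = 2 := by
    have h := index_sup_zpowers_mul_two Cy8.fixingSubgroup hc8 hc2
    rw [(index_fixingSubgroup Cy8).trans (finrank_cyclotomic_eight Cy8)] at h
    omega
  have hAA8 : A ≤ Cy8.fixingSubgroup ⊔ Subgroup.zpowers c :=
    sup_le_sup_right (IntermediateField.fixingSubgroup_le h8Cy) _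
  have hd2 : H' ⊔ Subgroup.zpowers c = ⊤ := by
    by_contra hne
    have hdvd : (H' ⊔ Subgroup.zpowers c).index ∣ B.index :=
      Subgroup.index_dvd_of_le ((le_sup_right : B ≤ H').trans le_sup_left)
    obtain ⟨j, hj⟩ := hBi
    rw [hj] at hdvd
    obtain ⟨t, -, ht⟩ := (Nat.dvd_prime_pow Nat.prime_two).mp hdvd
    have ht1 : 1 ≤ t := by
      by_contra h0
      rw [show t = 0 by omega, pow_zero, Subgroup.index_eq_one] at ht
      exact hne ht
    obtain ⟨H₂, hle₂, hH₂⟩ := exists_le_index_eq_two (H' ⊔ Subgroup.zpowers c) ht ht1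
    have hu : ∀ (Q : Ideal (𝓞 M₀)) [Q.IsMaximal], ((2 : ℕ) : 𝓞 M₀) ∉ Q →
        Q.inertia (M₀ ≃ₐ[ℚ] M₀) ≤ H' ⊔ Subgroup.zpowers c :=
      fun Q _ h => ((hBu Q h).trans (le_sup_right : B ≤ H')).trans le_sup_left
    have hcmem : c ∈ H' ⊔ Subgroup.zpowers c := Subgroup.mem_sup_right (Subgroup.mem_zpowers c)
    have hH₂eq := eq_sup_zpowers_of_index_two Cy8 hc2 hc8 hu hcmem hle₂ hH₂
    have htop : Cy8.fixingSubgroup ⊔ Subgroup.zpowers c = ⊤ := by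
      rw [eq_top_iff, ← hd1]
      exact sup_le (le_sup_left.trans (hle₂.trans hH₂eq.le)) hAA8
    rw [htop, Subgroup.index_top] at hA8i
    exact absurd hA8i (by norm_num)
  -- hence `[G : H'] ≤ 2` and `H_{Cy} ≤ H'` ("`F' = ℚ, ℚ[i]` or `ℚ[√-2]`")
  have hd3 : Cy.fixingSubgroup ≤ H' := by
    by_cases hcH' : c ∈ H'
    · have : H' = ⊤ := by
        rw [← hd2]; exact (sup_eq_left.mpr ((Subgroup.zpowers_le).mpr hcH')).symm
      rw [this]; exact le_top
    · have hH'i : H'.index = 2 := by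
        have h := index_sup_zpowers_mul_two H' hcH' hc2
        rw [hd2, Subgroup.index_top] at h
        omega
      haveI : H'.Normal := inferInstance
      have hfix : (IntermediateField.fixedField H').fixingSubgroup = H' :=
        IntermediateField.fixingSubgroup_fixedField H'
      have hfin : Module.finrank ℚ (IntermediateField.fixedField H') = 2 := by
        rw [← index_fixingSubgroup, hfix, hH'i]
      have hu : ∀ (Q : Ideal (𝓞 M₀)) [Q.IsMaximal], ((2 : ℕ) : 𝓞 M₀) ∉ Q →
          Q.inertia (M₀ ≃ₐ[ℚ] M₀) ≤ (IntermediateField.fixedField H').fixingSubgroup :=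
        fun Q _ h => by rw [hfix]; exact (hBu Q h).trans le_sup_right
      have hle := IntermediateField.le_cyclotomic_eight_of_finrank_eq_two Cy8 _ hfin hu
      rw [← hfix]
      exact IntermediateField.fixingSubgroup_le (hle.trans h8Cy)
  -- (e) `τ ^ 2ᵏ ∈ B`
  have he : τ ^ 2 ^ k ∈ B := by
    refine ⟨?_, ?_⟩
    · have := Subgroup.pow_index_mem F.fixingSubgroup τ; rwa [hHF] at this
    · have := Subgroup.pow_index_mem A τ; rwa [hAi] at this
  -- (f) `H_{Cy} ≤ A ∩ H' = B ≤ H_F`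
  have hf : Cy.fixingSubgroup ≤ B := by
    intro h hh
    have hhA : h ∈ A := Subgroup.mem_sup_left hh
    obtain ⟨y, hy, b, hb, rfl⟩ := Subgroup.mem_sup.mp (hd3 hh)
    obtain ⟨j, rfl⟩ := Subgroup.mem_zpowers_iff.mp hy
    have hτjA : τ ^ j ∈ A := by
      have := Subgroup.mul_mem _ hhA (Subgroup.inv_mem _ (hBA hb))
      rwa [mul_inv_cancel_right] at this
    have hdvd : ((2 ^ k : ℕ) : ℤ) ∣ j := by
      rw [← hordτ, orderOf_dvd_iff_zpow_eq_one, ← QuotientGroup.mk_zpow, QuotientGroup.eq_one_iff]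
      exact hτjA
    obtain ⟨i, rfl⟩ := hdvd
    refine Subgroup.mul_mem _ ?_ hb
    rw [zpow_mul, zpow_natCast]
    exact Subgroup.zpow_mem _ he i
  rw [← IsGalois.fixedField_fixingSubgroup F, ← IsGalois.fixedField_fixingSubgroup Cy]
  exact IntermediateField.fixedField_le (hf.trans inf_le_left)

end Ambient

end Literature.NumberTheory.NumberFields
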